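import Literature.NumberTheory.GaloisRepresentations.LubinTateComparisonDerivation
import Literature.NumberTheory.GaloisRepresentations.LubinTateColemanRelativeCoordGaloisTwo
import HarnessLib

/-!
# The relative Coates–Wiles homomorphisms over an unramified base `k′ = E` (`q = 2`): the moments of
# de Shalit's twisted tilde, `[X⁰] D_E^k ((δ_E g_β)~) = c − w·π^k·φ(c)`, `c = [X⁰] D_E^k (δ_E g_β) = φ^{CW}_{k+1}(β)`

Topic `NumberTheory/GaloisRepresentations`; namespace `Literature.NumberTheory.GaloisRepresentations`
(sequel of `LubinTateColemanRelativeCoordTwo.lean` — the RELATIVE Coleman theory over a finite unramified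
Galois base `E ⊆ F^{nr}`, `f = πX + X²`, `π = 2u`: relative Coleman series `g_β` (`𝒩_E g_β = g_β^φ`),
`δ_E` (`relLogDerivSeries`), and de Shalit's twisted tilde `relTildeSeries w β = δ_E g_β − w·((δ_E g_β)^φ ∘ f)` —
and of `LubinTateComparisonDerivation.lean`, the invariant derivations to all orders).

De Shalit, *Iwasawa theory of elliptic curves with complex multiplication* (1987), I §3.5 (11) (p. 18):
"`∫_G κ(σ)^k dμ_β(σ) = D^k log g_β (0)` […] The map `φ_k(β) = ∫_G κ(σ)^k dμ_β(σ)` is called the `k`-th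
Coates–Wiles homomorphism"; II §4.7 (15)–(17) (p. 60), semi-local over the unramified base:
"`δ_k(β) = D^k log(g_β ∘ θ)(0)` […] (17) `δ̃_k(β) = δ_k(β) − p^{k−1} σ_𝔭(δ_k(β))`" — the tilde costs an
Euler factor TWISTED BY THE FROBENIUS `σ_𝔭 = φ` of the base.  For the tree's relative objects, with the
relative invariant derivation `D_E = ω_f^E · d/dX` (`ω_f^E` = the tree's `invDiff` read in `𝒪_E⟦X⟧`, as in
`relLogDeriv`), this file proves (0 sorry, no definitions):

* §1 `map_invDiff_mul_derivative_ltSer` — `ω_f^E · (f^E)′ = C π · ω_f^E ∘ f^E` (the `[π]`-equivariance read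
  in `𝒪_E⟦X⟧`); ★ `constantCoeff_iterate_relDerivation_subst_ltSer`
  **`[X⁰] D_E^[k] (H ∘ f) = π^k · [X⁰] D_E^[k] H`** (`D(h ∘ [π]) = π·(Dh) ∘ [π]`, `[π]_f = f`, to all orders:
  `LubinTate.iterate_derivation_subst_of_pullback` with `ϑ := f`);
  ★ `map_frob_iterate_relDerivation` **`(D_E^[k] H)^φ = D_E^[k] (H^φ)`** (`ω_f^E` is `φ`-fixed);
* §2 ★★ `constantCoeff_iterate_relDerivation_relTildeSeries` —
  **`[X⁰] D_E^[k] ((δ_E g_β)~) = c − w · π^k · φ(c)`, `c = [X⁰] D_E^[k] (δ_E g_β)`** — de Shalit's (17):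
  the `k`-th moment of the log-free series is the RELATIVE COATES–WILES value `φ^{CW,E}_{k+1}(β) = c`
  corrected by the Frobenius-twisted Euler factor (for `π = p·w`: `c − (π^{k+1}/p)·φ(c)`);
  additivity `constantCoeff_iterate_relDerivation_relLogDerivSeries_mul` (`φ_{k+1}(ββ′) = φ_{k+1}(β) + φ_{k+1}(β′)`);
* §3 ★★ `[a]`-equivariance (de Shalit I §3.5 (ii) over `k′`): `constantCoeff_iterate_relDerivation_subst_homE`
  (`[X⁰] D_E^[k] (H ∘ [a]) = a^k [X⁰] D_E^[k] H`), `…_relLogDerivSeries_galAct` / `…_relTildeSeries_galAct`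
  **`φ^{CW,E}_{k+1}(σ̃·β) = χ_π(σ̃)^{k+1} · φ^{CW,E}_{k+1}(β)`** for `σ̃` fixing `E` (local inertia).

With `LubinTateComparisonDifferentialUnramified.lean` / `PAdicOneVariableSocketCoatesWilesTwo.lean` (the
comparison series carries `D_{Ĝ_m} = (1+S)d/dS` to `Ω_p · D_E`) this identifies the socket
`[S⁰] D^k (((δ_E g_β)~)^j ∘ ϑ)` of the measure lane's one-`𝔓` elliptic-unit measure
(`PAdicOneVariableSeriesFamilyOfRelNormCoherentUnits`, `…EllipticUnitsLocalMoments`) with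
`Ω_p^k · j(c − w π^k φ(c))`.  Cell `bsd-print-cf2`, width seat `bsd-line-cf2c-w4` g11.

## References

* [deShalit1987] E. de Shalit, *Iwasawa theory of elliptic curves with complex multiplication*,
  Perspectives in Math. 3 (1987), Ch. I §3.5 (11) (p. 18), §3.13, II §4.7 (15)–(17) (p. 60).
* [CoatesWiles1977] J. Coates, A. Wiles, *On the conjecture of Birch and Swinnerton-Dyer*, Invent.
  Math. 39 (1977).
-/

noncomputable section

open PowerSeries

namespace Literature.NumberTheory.GaloisRepresentations

/-! ### Helpers -/

/-- `(G^φ)(0) = φ(G(0))`. [folklore] -/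
private theorem constantCoeff_map' {A T : Type*} [CommRing A] [CommRing T] (φ : A →+* T) (G : A⟦X⟧) :
    constantCoeff (G.map φ) = φ (constantCoeff G) := by
  rw [← coeff_zero_eq_constantCoeff_apply, coeff_map, coeff_zero_eq_constantCoeff_apply]

/-- `d⁄dX` commutes with coefficientwise maps. [folklore] -/
private theorem derivative_map' {A T : Type*} [CommRing A] [CommRing T] (φ : A →+* T) (G : A⟦X⟧) :
    d⁄dX T (G.map φ) = (d⁄dX A G).map φ := by
  ext n
  simp only [coeff_derivative, coeff_map, map_mul, map_add, map_natCast, map_one]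

/-- `D^[k]` for `D = ϖ · d/dX` is additive. [folklore] -/
private theorem iterate_derivation_add {A : Type*} [CommRing A] (ϖ : A⟦X⟧) (k : ℕ) (G H : A⟦X⟧) :
    (fun g : A⟦X⟧ => ϖ * d⁄dX A g)^[k] (G + H) =
      (fun g : A⟦X⟧ => ϖ * d⁄dX A g)^[k] G + (fun g : A⟦X⟧ => ϖ * d⁄dX A g)^[k] H := by
  induction k generalizing G H with
  | zero => rfl
  | succ k ih => rw [Function.iterate_succ_apply, Function.iterate_succ_apply, Function.iterate_succ_apply,
      map_add, mul_add, ih]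

/-- `D^[k]` for `D = ϖ · d/dX` commutes with subtraction. [folklore] -/
private theorem iterate_derivation_sub {A : Type*} [CommRing A] (ϖ : A⟦X⟧) (k : ℕ) (G H : A⟦X⟧) :
    (fun g : A⟦X⟧ => ϖ * d⁄dX A g)^[k] (G - H) =
      (fun g : A⟦X⟧ => ϖ * d⁄dX A g)^[k] G - (fun g : A⟦X⟧ => ϖ * d⁄dX A g)^[k] H := by
  induction k generalizing G H with
  | zero => rfl
  | succ k ih => rw [Function.iterate_succ_apply, Function.iterate_succ_apply, Function.iterate_succ_apply,
      map_sub, mul_sub, ih]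

section RelativeCoatesWilesTwo

open Literature.NumberTheory.GaloisRepresentations.IsNonarchimedeanLocalField LubinTate ValuativeRel Field

variable {F : Type} [Field F] [ValuativeRel F] [TopologicalSpace F] [IsNonarchimedeanLocalField F]

attribute [local instance] ltNormUniformSpace ltNormIsUniformAddGroup rk1 nF nE fintypeResidueField

variable {π : 𝒪[F]} (hπ : (valuation F).IsUniformizer (π : F))
variable (E : IntermediateField F (AlgebraicClosure F)) [FiniteDimensional F E] [Normal F E] [IsGalois F E]
variable (hq : residueFieldCard F = 2) (hE : E ≤ maxUnramified F) {σ₀ : absoluteGaloisGroup F} (hσ₀ : IsAbsArithFrob σ₀)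

/-! ### §1 The relative invariant derivation `D_E = ω_f^E · d/dX`: `[π]`-equivariance and Frobenius -/

omit [Normal F E] [IsGalois F E] in
/-- **`ω_f^E · (f^E)′ = C π · ω_f^E ∘ f^E`** in `𝒪_E⟦X⟧`: the `[π]`-equivariance of the invariant differential
(`invDiff_mul_derivative_ltSer`), read over the base `E`. [cite: deShalit1987, Ch. I §3.5 (p. 18)] -/
theorem map_invDiff_mul_derivative_ltSer :
    (invDiff (isLTRing_LTCoeff hπ) (isLTSeries_LTCoeff π)).map (algebraMap (LTCoeff F) (unitBall E)) *
        d⁄dX (unitBall E) ((ltSer F π).map (algebraMap (LTCoeff F) (unitBall E))) =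
      C (algebraMap (LTCoeff F) (unitBall E) (LTCoeff.of F π)) *
        ((invDiff (isLTRing_LTCoeff hπ) (isLTSeries_LTCoeff π)).map (algebraMap (LTCoeff F) (unitBall E))).subst
          ((ltSer F π).map (algebraMap (LTCoeff F) (unitBall E))) := by
  have hs : HasSubst (ltSer F π) :=
    HasSubst.of_constantCoeff_zero' (isLTSeries_LTCoeff π).constantCoeff_eq_zero
  have h := congrArg (PowerSeries.map (algebraMap (LTCoeff F) (unitBall E)))
    (invDiff_mul_derivative_ltSer (F := F) hπ)
  rw [map_mul, map_mul, ← derivative_map', map_C, map_subst_one' _ hs] at h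
  exact h

omit [Normal F E] [IsGalois F E] in
/-- ★ **`[X⁰] D_E^[k] (H ∘ f^E) = π^k · [X⁰] D_E^[k] H`** — `D_E(h ∘ [π]_f) = π · (D_E h) ∘ [π]_f` with `[π]_f = f`,
to all orders, at the origin. [cite: deShalit1987, Ch. I §3.5 (p. 18), II §4.7 (17) (p. 60)] -/
theorem constantCoeff_iterate_relDerivation_subst_ltSer (k : ℕ) (H : PowerSeries (unitBall E)) :
    constantCoeff ((fun g : PowerSeries (unitBall E) =>
        (invDiff (isLTRing_LTCoeff hπ) (isLTSeries_LTCoeff π)).map (algebraMap (LTCoeff F) (unitBall E)) *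
          d⁄dX (unitBall E) g)^[k] (H.subst ((ltSer F π).map (algebraMap (LTCoeff F) (unitBall E))))) =
      algebraMap (LTCoeff F) (unitBall E) (LTCoeff.of F π) ^ k *
        constantCoeff ((fun g : PowerSeries (unitBall E) =>
          (invDiff (isLTRing_LTCoeff hπ) (isLTSeries_LTCoeff π)).map (algebraMap (LTCoeff F) (unitBall E)) *
            d⁄dX (unitBall E) g)^[k] H) :=
  constantCoeff_iterate_derivation_subst_of_pullback ((isLTSeries_ltSer π).map _).constantCoeff_eq_zero
    (map_invDiff_mul_derivative_ltSer hπ E) k H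

omit [IsGalois F E] in
/-- ★ **`D_E` commutes with the Frobenius of the base**: `(D_E^[k] H)^φ = D_E^[k] (H^φ)` (`ω_f^E` has
coefficients in `𝒪_F`, fixed by `φ`). [cite: deShalit1987, Ch. I §1.1, II §4.7 (17) (p. 60)] -/
theorem map_frob_iterate_relDerivation (k : ℕ) (H : PowerSeries (unitBall E)) :
    ((fun g : PowerSeries (unitBall E) =>
        (invDiff (isLTRing_LTCoeff hπ) (isLTSeries_LTCoeff π)).map (algebraMap (LTCoeff F) (unitBall E)) *
          d⁄dX (unitBall E) g)^[k] H).map (frobUnitBall E σ₀ : unitBall E →+* unitBall E) =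
      (fun g : PowerSeries (unitBall E) =>
        (invDiff (isLTRing_LTCoeff hπ) (isLTSeries_LTCoeff π)).map (algebraMap (LTCoeff F) (unitBall E)) *
          d⁄dX (unitBall E) g)^[k] (H.map (frobUnitBall E σ₀ : unitBall E →+* unitBall E)) := by
  have hfix : ((invDiff (isLTRing_LTCoeff hπ) (isLTSeries_LTCoeff π)).map (algebraMap (LTCoeff F) (unitBall E))).map
      (frobUnitBall E σ₀ : unitBall E →+* unitBall E) =
      (invDiff (isLTRing_LTCoeff hπ) (isLTSeries_LTCoeff π)).map (algebraMap (LTCoeff F) (unitBall E)) := by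
    have hc : (frobUnitBall E σ₀ : unitBall E →+* unitBall E).comp (algebraMap (LTCoeff F) (unitBall E)) =
        algebraMap (LTCoeff F) (unitBall E) := RingHom.ext fun a => frobUnitBall_algebraMap_LTCoeff E σ₀ a
    rw [← RingHom.comp_apply (PowerSeries.map (frobUnitBall E σ₀ : unitBall E →+* unitBall E))
        (PowerSeries.map (algebraMap (LTCoeff F) (unitBall E))), ← PowerSeries.map_comp, hc]
  have h := map_iterate_derivation (frobUnitBall E σ₀ : unitBall E →+* unitBall E)
    ((invDiff (isLTRing_LTCoeff hπ) (isLTSeries_LTCoeff π)).map (algebraMap (LTCoeff F) (unitBall E))) k H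
  rw [hfix] at h
  exact h.symm

/-! ### §2 The moments of the twisted tilde: the relative Coates–Wiles value and its Euler factor -/

/-- ★★ **de Shalit's (17) over the unramified base**: for `β ∈ 𝒰_E` and every tilde parameter `w`,
`[X⁰] D_E^[k] ((δ_E g_β)~) = c − w · π^k · φ(c)` with `c = [X⁰] D_E^[k] (δ_E g_β)` the relative Coates–Wiles
value `φ^{CW,E}_{k+1}(β) = D_E^{k+1} log g_β (0)` (`(δ_E g_β)~ = δ_E g_β − w·((δ_E g_β)^φ ∘ f)`).
[cite: deShalit1987, Ch. I §3.5 (11) (p. 18), II §4.7 (17) (p. 60)] -/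
theorem constantCoeff_iterate_relDerivation_relTildeSeries (w : LTCoeff F) (k : ℕ)
    (β : RelNormCoherentUnits hπ E) :
    constantCoeff ((fun g : PowerSeries (unitBall E) =>
        (invDiff (isLTRing_LTCoeff hπ) (isLTSeries_LTCoeff π)).map (algebraMap (LTCoeff F) (unitBall E)) *
          d⁄dX (unitBall E) g)^[k] (relTildeSeries hπ E hq hE hσ₀ w β)) =
      constantCoeff ((fun g : PowerSeries (unitBall E) =>
          (invDiff (isLTRing_LTCoeff hπ) (isLTSeries_LTCoeff π)).map (algebraMap (LTCoeff F) (unitBall E)) *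
            d⁄dX (unitBall E) g)^[k] (relLogDerivSeries hπ E hq hE hσ₀ β)) -
        algebraMap (LTCoeff F) (unitBall E) w * algebraMap (LTCoeff F) (unitBall E) (LTCoeff.of F π) ^ k *
          (frobUnitBall E σ₀ : unitBall E →+* unitBall E)
            (constantCoeff ((fun g : PowerSeries (unitBall E) =>
              (invDiff (isLTRing_LTCoeff hπ) (isLTSeries_LTCoeff π)).map (algebraMap (LTCoeff F) (unitBall E)) *
                d⁄dX (unitBall E) g)^[k] (relLogDerivSeries hπ E hq hE hσ₀ β))) := by
  rw [relTildeSeries, iterate_derivation_sub, map_sub, iterate_derivation_C_mul, map_mul, constantCoeff_C,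
    constantCoeff_iterate_relDerivation_subst_ltSer hπ E, ← map_frob_iterate_relDerivation hπ E, constantCoeff_map']
  ring

/-- The relative Coates–Wiles values are additive: `φ^{CW,E}_{k+1}(ββ′) = φ^{CW,E}_{k+1}(β) + φ^{CW,E}_{k+1}(β′)`
(de Shalit I §3.5 (i) over `k′`). [cite: deShalit1987, Ch. I §3.5 (i) (p. 18)] -/
theorem constantCoeff_iterate_relDerivation_relLogDerivSeries_mul (k : ℕ) (β β' : RelNormCoherentUnits hπ E) :
    constantCoeff ((fun g : PowerSeries (unitBall E) =>
        (invDiff (isLTRing_LTCoeff hπ) (isLTSeries_LTCoeff π)).map (algebraMap (LTCoeff F) (unitBall E)) *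
          d⁄dX (unitBall E) g)^[k] (relLogDerivSeries hπ E hq hE hσ₀ (β.mul β'))) =
      constantCoeff ((fun g : PowerSeries (unitBall E) =>
          (invDiff (isLTRing_LTCoeff hπ) (isLTSeries_LTCoeff π)).map (algebraMap (LTCoeff F) (unitBall E)) *
            d⁄dX (unitBall E) g)^[k] (relLogDerivSeries hπ E hq hE hσ₀ β)) +
        constantCoeff ((fun g : PowerSeries (unitBall E) =>
          (invDiff (isLTRing_LTCoeff hπ) (isLTSeries_LTCoeff π)).map (algebraMap (LTCoeff F) (unitBall E)) *
            d⁄dX (unitBall E) g)^[k] (relLogDerivSeries hπ E hq hE hσ₀ β')) := by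
  rw [relLogDerivSeries_mul, iterate_derivation_add, map_add]


/-! ### §3 `[a]`-equivariance: `φ^{CW,E}_{k+1}(σ̃·β) = χ_π(σ̃)^{k+1} · φ^{CW,E}_{k+1}(β)` (de Shalit I §3.5 (ii)) -/

omit [Normal F E] [IsGalois F E] in
/-- ★ **`[X⁰] D_E^[k] (H ∘ [a]_f^E) = a^k · [X⁰] D_E^[k] H`** (de Shalit I §3.5 (ii) at the level of series over `E`).
[cite: deShalit1987, Ch. I §3.5 (ii) (p. 18)] -/
theorem constantCoeff_iterate_relDerivation_subst_homE (a : 𝒪[F]) (k : ℕ) (H : PowerSeries (unitBall E)) :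
    constantCoeff ((fun g : PowerSeries (unitBall E) =>
        (invDiff (isLTRing_LTCoeff hπ) (isLTSeries_LTCoeff π)).map (algebraMap (LTCoeff F) (unitBall E)) *
          d⁄dX (unitBall E) g)^[k] (H.subst (homE hπ E a))) =
      algebraMap 𝒪[F] (unitBall E) a ^ k *
        constantCoeff ((fun g : PowerSeries (unitBall E) =>
          (invDiff (isLTRing_LTCoeff hπ) (isLTSeries_LTCoeff π)).map (algebraMap (LTCoeff F) (unitBall E)) *
            d⁄dX (unitBall E) g)^[k] H) :=
  constantCoeff_iterate_derivation_subst_of_pullback (constantCoeff_homE hπ E a)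
    (map_invDiff_mul_derivative_homE hπ E a) k H

/-- ★★ **`φ^{CW,E}_{k+1}(σ̃·β) = χ_π(σ̃)^{k+1} · φ^{CW,E}_{k+1}(β)`** for `σ̃ ∈ Γ_F` fixing `E` pointwise (de Shalit
I §3.5 (ii) over `k′`: `δ_E g_{σ̃β} = χ_π(σ̃) · (δ_E g_β) ∘ [χ_π(σ̃)]_f`, tree `relLogDerivSeries_galAct`).
[cite: deShalit1987, Ch. I §3.5 (ii) (p. 18), II §4.5 (iv) (p. 59)] -/
theorem constantCoeff_iterate_relDerivation_relLogDerivSeries_galAct (k : ℕ) (β : RelNormCoherentUnits hπ E)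
    {σ : absoluteGaloisGroup F} (hσE : ∀ x : E, σ • (x : AlgebraicClosure F) = x) :
    constantCoeff ((fun g : PowerSeries (unitBall E) =>
        (invDiff (isLTRing_LTCoeff hπ) (isLTSeries_LTCoeff π)).map (algebraMap (LTCoeff F) (unitBall E)) *
          d⁄dX (unitBall E) g)^[k] (relLogDerivSeries hπ E hq hE hσ₀ (β.galAct σ))) =
      algebraMap 𝒪[F] (unitBall E) (lubinTateChar hπ σ : 𝒪[F]) ^ (k + 1) *
        constantCoeff ((fun g : PowerSeries (unitBall E) =>
          (invDiff (isLTRing_LTCoeff hπ) (isLTSeries_LTCoeff π)).map (algebraMap (LTCoeff F) (unitBall E)) *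
            d⁄dX (unitBall E) g)^[k] (relLogDerivSeries hπ E hq hE hσ₀ β)) := by
  rw [relLogDerivSeries_galAct hπ E hq hE hσ₀ β hσE, iterate_derivation_C_mul, map_mul, constantCoeff_C,
    constantCoeff_iterate_relDerivation_subst_homE, pow_succ]
  ring

/-- ★★ **… and for the twisted tilde**: `[X⁰] D_E^[k] ((δ_E g_{σ̃β})~) = χ_π(σ̃)^{k+1} · [X⁰] D_E^[k] ((δ_E g_β)~)`
(tree `relTildeSeries_galAct`: `(δ(σ̃β))~ = χ · (δβ)~ ∘ [χ]_f`) — de Shalit's Lemma I.3.4 (ii) / I §3.5 (ii) on moments.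
[cite: deShalit1987, Ch. I §3.4 Lemma (ii), §3.5 (ii) (p. 18)] -/
theorem constantCoeff_iterate_relDerivation_relTildeSeries_galAct (w : LTCoeff F) (k : ℕ)
    (β : RelNormCoherentUnits hπ E) {σ : absoluteGaloisGroup F} (hσE : ∀ x : E, σ • (x : AlgebraicClosure F) = x) :
    constantCoeff ((fun g : PowerSeries (unitBall E) =>
        (invDiff (isLTRing_LTCoeff hπ) (isLTSeries_LTCoeff π)).map (algebraMap (LTCoeff F) (unitBall E)) *
          d⁄dX (unitBall E) g)^[k] (relTildeSeries hπ E hq hE hσ₀ w (β.galAct σ))) =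
      algebraMap 𝒪[F] (unitBall E) (lubinTateChar hπ σ : 𝒪[F]) ^ (k + 1) *
        constantCoeff ((fun g : PowerSeries (unitBall E) =>
          (invDiff (isLTRing_LTCoeff hπ) (isLTSeries_LTCoeff π)).map (algebraMap (LTCoeff F) (unitBall E)) *
            d⁄dX (unitBall E) g)^[k] (relTildeSeries hπ E hq hE hσ₀ w β)) := by
  rw [relTildeSeries_galAct hπ E hq hE hσ₀ w β hσE, iterate_derivation_C_mul, map_mul, constantCoeff_C,
    constantCoeff_iterate_relDerivation_subst_homE, pow_succ]
  ring

end RelativeCoatesWilesTwo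

end Literature.NumberTheory.GaloisRepresentations

end
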